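import Literature.Computability.Cryptography.IndistinguishabilityReplacement
import Literature.Computability.Cryptography.IndistinguishabilityPostProcessing
import Literature.Computability.Cryptography.LubyRackoff
import Literature.Computability.Cryptography.PRGStretchExtension
import HarnessLib

/-!
# The XOR combiner: if one candidate generator is pseudorandom, the XOR of all candidates is (HILL, step 4)

The last step of Håstad–Impagliazzo–Levin–Luby's construction of a pseudorandom generator from any
one-way function, as summarised by Haitner–Reingold–Vadhan (SIAM J. Comput. 42 (2013), §1.1, "The HILL
Construction", item *Enumeration*): "Håstad et al. enumerate over all `u = O(n/Δ)` possible values `k`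
for the output entropy …, construct a pseudorandom generator `G_k` for each, … and then take
`G(x₁, …, x_u) = G₁(x₁) ⊕ ⋯ ⊕ G_u(x_u)` as their final pseudorandom generator." The point: for the
(unknown, possibly non-computable) correct guess `k₀ = k₀(n)` the candidate `G_{k₀}` is pseudorandom,
and XOR-ing independent strings with a pseudorandom one gives a pseudorandom string.

This file proves that combiner statement in the tree's model. The `u(n) = m(n)` candidates are one
`FP` sampler `S` reading the candidate's index in unary, `G_i(s) = S(⟨1ⁿ, ⟨1ⁱ, s⟩⟩)` (seeds of `a(n)`
bits, outputs of a common length `L(n)`), exactly the indexed samplers of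
`IndistinguishabilityRepeatedIndexed.lean` / `IndistinguishabilityReplacement.lean`:

* `xorBlocks L bs` — `0^L ⊕ b₁ ⊕ ⋯ ⊕ b_M` (the tree's clamped `bxor` of `LubyRackoff.lean`), with the
  algebra on `L`-bit strings (`bxor_comm_of_length_eq`, `foldl_bxor_pull`) and
  **`uniformBits_map_bxor_left`**: `c ⊕ U_L ≡ U_L` for `|c| = L`;
* `XorComb.xorFoldFn S a m` — the map `⟨1ⁿ, h⟩ ↦ ⊕_{i<m(n)} (block i of h)` as an `FP` string function
  (a `Brick.foldLoop` of `LubyRackoff.bxorFn`), with its value on genuine inputs (`xorFoldFn_apply`);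
* **`isPseudorandom_xorCombiner`** — if `S ∈ FP` has common output length `L(n)`, `k₀(n) < m(n)`, and
  the `k₀(n)`-th candidate `n ↦ S(⟨1ⁿ, ⟨1^{k₀(n)}, U_{a(n)}⟩⟩)` is pseudorandom, then
  `n ↦ ⊕_{i<m(n)} S(⟨1ⁿ, ⟨1ⁱ, sᵢ⟩⟩)` (`sᵢ ← U_{a(n)}` independent) is pseudorandom against `U_{L(n)}`.
  Proof: replace the `k₀(n)`-th component by `U_{L(n)}` (`isCompIndistinguishable_prodEnsembleI_replEnsemble`),
  apply the XOR fold (`IsCompIndistinguishable.map_fp`), and compute that the fold of the replaced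
  tuple is exactly uniform (`uniformBits_map_bxor_left`, `PMF.bind_comm`).

## References

* J. Håstad, R. Impagliazzo, L. A. Levin, M. Luby, *A pseudorandom generator from any one-way
  function*, SIAM J. Comput. 28 (1999) 1364–1396, §4 (enumeration of the entropy guesses and the
  XOR of the candidate generators).
* I. Haitner, O. Reingold, S. Vadhan, *Efficiency improvements in constructing pseudorandom
  generators from one-way functions*, SIAM J. Comput. 42 (2013), §1.1 ("Enumeration").
* O. Goldreich, *Foundations of Cryptography I*, CUP 2001, §3.2.3 (hybrid technique), Construction
  3.7.6 (bit-by-bit XOR).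
-/

namespace Literature.Computability.Cryptography

open Filter Asymptotics Polynomial _root_.Computability Complexity Complexity.Brick Complexity.Plumb
  Hybrid PRGTrunc PRGPrefix PRGStretch RepSamp RepSampI LubyRackoff

/-! ### XOR of `L`-bit blocks -/

/-- `xorBlocks L [b₁, …, b_M] = 0^L ⊕ b₁ ⊕ ⋯ ⊕ b_M` (left fold of the clamped `bxor`, so the result has
length `L`). [cite: Goldreich2001, Construction 3.7.6 (bit-by-bit XOR)] -/
def xorBlocks (L : ℕ) (bs : List (List Bool)) : List Bool := bs.foldl bxor (List.replicate L false)

/-- A left fold of `bxor` keeps the accumulator's length. [folklore] -/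
theorem length_foldl_bxor (acc : List Bool) : ∀ bs : List (List Bool), (bs.foldl bxor acc).length = acc.length
  | [] => rfl
  | b :: bs => by rw [List.foldl_cons, length_foldl_bxor, length_bxor]

/-- `|xorBlocks L bs| = L`. [folklore] -/
@[simp] theorem length_xorBlocks (L : ℕ) (bs : List (List Bool)) : (xorBlocks L bs).length = L := by
  rw [xorBlocks, length_foldl_bxor, List.length_replicate]

/-- `bxor` is commutative on strings of equal length. [folklore] -/
theorem bxor_comm_of_length_eq {a b : List Bool} (h : a.length = b.length) : bxor a b = bxor b a := by
  apply List.ext_getElem (by simp [h])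
  intro i h₁ h₂
  rw [getElem_bxor, getElem_bxor, Bool.xor_comm]

/-- `bxor` is associative when the middle string is as long as the first. [folklore] -/
theorem bxor_assoc_of_length_eq {a b : List Bool} (h : a.length = b.length) (c : List Bool) :
    bxor (bxor a b) c = bxor a (bxor b c) := by
  apply List.ext_getElem (by simp)
  intro i h₁ h₂
  have hi : i < a.length := by simpa using h₁
  rw [getElem_bxor, getElem_bxor, getD_bxor hi, getD_bxor (h ▸ hi), Bool.xor_assoc]

/-- Right-commutation: `(z ⊕ α) ⊕ b = (z ⊕ b) ⊕ α` for strings of equal length. [folklore] -/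
theorem bxor_right_comm {z α b : List Bool} (hz : z.length = α.length) (hb : b.length = α.length) :
    bxor (bxor z α) b = bxor (bxor z b) α := by
  rw [bxor_assoc_of_length_eq hz, bxor_comm_of_length_eq (a := α) (b := b) hb.symm,
    ← bxor_assoc_of_length_eq (hz.trans hb.symm)]

/-- **Pulling one block out of the fold**: for an accumulator and blocks of a common length,
`fold (A ++ α :: B) = fold (A ++ B) ⊕ α`. [folklore] -/
theorem foldl_bxor_pull {L : ℕ} {α : List Bool} (hα : α.length = L) :
    ∀ (B : List (List Bool)) (z : List Bool), z.length = L → (∀ b ∈ B, b.length = L) →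
      B.foldl bxor (bxor z α) = bxor (B.foldl bxor z) α
  | [], z, _, _ => rfl
  | b :: B, z, hz, hB => by
    rw [List.foldl_cons, List.foldl_cons,
      bxor_right_comm (hz.trans hα.symm) ((hB b List.mem_cons_self).trans hα.symm)]
    exact foldl_bxor_pull hα B (bxor z b) (by rw [length_bxor, hz]) fun b' hb' => hB b' (List.mem_cons_of_mem _ hb')

/-- `xorBlocks` with one block pulled out: `xorBlocks L (A ++ α :: B) = xorBlocks L (A ++ B) ⊕ α`.
[folklore] -/
theorem xorBlocks_append_cons {L : ℕ} {α : List Bool} (hα : α.length = L) {A B : List (List Bool)}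
    (hB : ∀ b ∈ B, b.length = L) :
    xorBlocks L (A ++ α :: B) = bxor (xorBlocks L (A ++ B)) α := by
  simp only [xorBlocks, List.foldl_append, List.foldl_cons]
  exact foldl_bxor_pull hα B _ (by rw [length_foldl_bxor, List.length_replicate]) hB

/-! ### A uniform string XOR-ed with anything independent stays uniform -/

/-- **`c ⊕ U_L ≡ U_L`** for `|c| = L`: XOR with a fixed string permutes `{0,1}^L`.
[Goldreich 2001, §3.7 (one-time pad step); folklore] [folklore] -/
theorem uniformBits_map_bxor_left {L : ℕ} {c : List Bool} (hc : c.length = L) :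
    (uniformBits L).map (bxor c) = uniformBits L := by
  classical
  -- `c ⊕ (c ⊕ v) = v` for `|v| = L`
  have hinv : ∀ v : List Bool, v.length = L → bxor c (bxor c v) = v := by
    intro v hv
    apply List.ext_getElem (by rw [length_bxor, hc, hv])
    intro i h₁ h₂
    have hi : i < c.length := by rw [length_bxor] at h₁; exact h₁
    rw [getElem_bxor, getD_bxor hi, ← Bool.xor_assoc, Bool.xor_self, Bool.false_xor, List.getD_eq_getElem _ _ h₂]
  ext w
  rw [PMF.map_apply, uniformBits_apply_eq]
  by_cases hw : w.length = L
  · rw [if_pos hw, tsum_eq_single (bxor c w)]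
    · rw [if_pos (hinv w hw).symm, uniformBits_apply_eq, if_pos (by rw [length_bxor, hc])]
    · intro v hv
      by_cases hvl : v.length = L
      · rw [if_neg]
        intro hvw
        exact hv (by rw [hvw, hinv v hvl])
      · simp [uniformBits_apply_eq, hvl]
  · rw [if_neg hw]
    refine ENNReal.tsum_eq_zero.2 fun v => ?_
    by_cases hvl : v.length = L
    · rw [if_neg]
      intro hvw
      exact hw (by rw [hvw, length_bxor, hc])
    · simp [uniformBits_apply_eq, hvl]

/-- **XOR with an independent uniform string is uniform**: for any law `q` and reading `g` of length `L`,
`(U_L).bind (α ↦ q.map (z ↦ g z ⊕ α)) = U_L`. [Goldreich 2001, §3.7 / one-time pad; folklore] [folklore] -/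
theorem uniformBits_bind_map_bxor {β : Type} {L : ℕ} (q : PMF β) {g : β → List Bool} (hg : ∀ z, (g z).length = L) :
    ((uniformBits L).bind fun α => q.map fun z => bxor (g z) α) = uniformBits L := by
  have h1 : ((uniformBits L).bind fun α => q.map fun z => bxor (g z) α) =
      q.bind fun z => (uniformBits L).map (bxor (g z)) := by
    simp only [PMF.map, Function.comp_def]
    rw [PMF.bind_comm]
  rw [h1]
  conv_lhs => arg 2; ext z; rw [uniformBits_map_bxor_left (hg z)]
  exact PMF.bind_const _ _

/-! ### The XOR fold as a polynomial-time string function -/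

namespace XorComb

variable (S : List Bool → List Bool) (a m : Polynomial ℕ)

/-- From a string `w` whose first pair component is `u`: `1^{L}` with `L = |S(⟨u, ⟨ε, 0^{a(|u|)}⟩⟩)|`
(the candidates' common output length, computed by running `S` once). [folklore] -/
noncomputable def lenF : List Bool → List Bool :=
  onesFn ∘ S ∘ fanoutFn fstF (fanoutFn (fun _ => []) (Kannan.zerosFn ∘ polyFn a ∘ fstF))

/-- Value of `lenF` on a string with first component `u`. [folklore] -/
theorem lenF_apply (u h : List Bool) :
    lenF S a (boolPair u h) = ones (S (boolPair u (boolPair [] (List.replicate (a.eval u.length) false)))).length := by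
  simp [lenF, onesFn, Complexity.unaryEncodeNat_eq_replicate, ones]

/-- `lenF ∈ FP` for `S ∈ FP`. [folklore] -/
theorem lenF_mem_FP (hS : S ∈ FP) : lenF S a ∈ FP :=
  comp_mem_FP onesFn_mem_FP (comp_mem_FP hS (fanoutFn_mem_FP fstF_mem_FP
    (fanoutFn_mem_FP (const_mem_FP []) (comp_mem_FP Kannan.zerosFn_mem_FP (comp_mem_FP (polyFn_mem_FP a) fstF_mem_FP)))))

/-- The piece of the fold: on `⟨x, 1ʲ⟩` with `x = ⟨u, h⟩`, block `j` of `h` (of length `L`). [folklore] -/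
noncomputable def pieceX : List Bool → List Bool :=
  takeFn ∘ fanoutFn (lenF S a ∘ fstF) (dropFn ∘ fanoutFn (HashBricks.umulFn ∘ fanoutFn sndF (lenF S a ∘ fstF)) (sndF ∘ fstF))

/-- Value of `pieceX`. [folklore] -/
theorem pieceX_apply (u h : List Bool) (j : ℕ) :
    pieceX S a (boolPair (boolPair u h) (ones j)) =
      blk (S (boolPair u (boolPair [] (List.replicate (a.eval u.length) false)))).length j h := by
  simp [pieceX, lenF_apply, Hybrid.blk, HashBricks.umulFn_apply, ones]

/-- `pieceX ∈ FP`. [folklore] -/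
theorem pieceX_mem_FP (hS : S ∈ FP) : pieceX S a ∈ FP :=
  comp_mem_FP takeFn_mem_FP (fanoutFn_mem_FP (comp_mem_FP (lenF_mem_FP S a hS) fstF_mem_FP)
    (comp_mem_FP dropFn_mem_FP (fanoutFn_mem_FP
      (comp_mem_FP HashBricks.umulFn_mem_FP (fanoutFn_mem_FP sndF_mem_FP (comp_mem_FP (lenF_mem_FP S a hS) fstF_mem_FP)))
      (comp_mem_FP sndF_mem_FP fstF_mem_FP))))

/-- The fold operation: `⟨acc, b⟩ ↦ acc ⊕ b` (the tree's `LubyRackoff.bxorFn` after the pair normaliser,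
so that its value and growth are known on every string). [folklore] -/
noncomputable def opX : List Bool → List Bool := bxorFn ∘ fanoutFn fstF sndF

/-- Value of `opX` on every string. [folklore] -/
theorem opX_apply (w : List Bool) : opX w = bxor (fstF w) (sndF w) := by
  rw [opX, Function.comp_apply, fanoutFn_apply, bxorFn_boolPair]

/-- Growth of `opX`: `|acc ⊕ b| = |acc|`. [folklore] -/
theorem length_opX_le (w : List Bool) : (opX w).length ≤ (fstF w).length + (sndF w).length + 0 := by
  rw [opX_apply, length_bxor]; omega

/-- `opX ∈ FP`. [folklore] -/
theorem opX_mem_FP : opX ∈ FP := comp_mem_FP bxorFn_mem_FP (fanoutFn_mem_FP fstF_mem_FP sndF_mem_FP)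

/-- The fold of `opX` is the left fold of `bxor` over the pieces. [folklore] -/
theorem foldAcc_opX (f : List Bool → List Bool) (x : List Bool) : ∀ (k i : ℕ) (acc : List Bool),
    foldAcc opX f x i k acc = ((List.range k).map fun j => f (boolPair x (ones (i + j)))).foldl bxor acc
  | 0, i, acc => by simp
  | k + 1, i, acc => by
    rw [foldAcc_succ', foldAcc_opX f x k i acc, opX_apply, fstF_boolPair, sndF_boolPair, List.range_succ,
      List.map_append, List.foldl_append, List.map_singleton, List.foldl_cons, List.foldl_nil]

/-- The initial record: `⟨w, ⟨bin m(|u|), ⟨ε, 0^L⟩⟩⟩`. [folklore] -/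
noncomputable def initX : List Bool → List Bool :=
  fanoutFn id (fanoutFn (lenBinF ∘ polyFn m ∘ fstF) (fanoutFn (fun _ => []) (Kannan.zerosFn ∘ lenF S a)))

/-- `initX ∈ FP`. [folklore] -/
theorem initX_mem_FP (hS : S ∈ FP) : initX S a m ∈ FP :=
  fanoutFn_mem_FP (PolyTimeComputable.id _) (fanoutFn_mem_FP
    (comp_mem_FP lenBinF_mem_FP (comp_mem_FP (polyFn_mem_FP m) fstF_mem_FP))
    (fanoutFn_mem_FP (const_mem_FP []) (comp_mem_FP Kannan.zerosFn_mem_FP (lenF_mem_FP S a hS))))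

/-- **The XOR fold** `⟨u, h⟩ ↦ 0^L ⊕ (block 0 of h) ⊕ ⋯ ⊕ (block m(|u|)−1 of h)`, as an `FP` string
function. [cite: HastadImpagliazzoLevinLuby1999, §4 (XOR of the candidate generators)] -/
noncomputable def xorFoldFn : List Bool → List Bool :=
  sndPow 2 ∘ foldLoop opX (clipF 1 (pieceX S a)) m ∘ initX S a m

/-- `xorFoldFn ∈ FP` for `S ∈ FP`. [Arora–Barak 2009, §1.3, §1.4.1] [cite: AroraBarak2009, §1.3] -/
theorem xorFoldFn_mem_FP (hS : S ∈ FP) : xorFoldFn S a m ∈ FP :=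
  comp_mem_FP (sndPow_mem_FP 2) (comp_mem_FP
    (foldLoop_clipF_mem_FP 1 opX_mem_FP length_opX_le (pieceX_mem_FP S a hS) m) (initX_mem_FP S a m hS))

variable {S a m}

/-- `|1ⁿ| = n` (private restatement of Mathlib's `unary_decode_encode_nat`). [folklore] -/
private theorem length_unary_x (n : ℕ) : (unaryEncodeNat n).length = n := unary_decode_encode_nat n

/-- **Value of the XOR fold on genuine inputs**: for `S` of common output length `L(n)` (every position)
and `h` of length `m(n)·L(n)`, `xorFoldFn ⟨1ⁿ, h⟩ = xorBlocks L(n) (block 0 of h, …, block m(n)−1 of h)`.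
[cite: HastadImpagliazzoLevinLuby1999, §4] -/
theorem xorFoldFn_apply {L : ℕ → ℕ} (hb : HasOutLenI S a L) {n : ℕ} {h : List Bool} (hh : h.length = m.eval n * L n) :
    xorFoldFn S a m (boolPair (unaryEncodeNat n) h) =
      xorBlocks (L n) ((List.range (m.eval n)).map fun j => blk (L n) j h) := by
  set u := unaryEncodeNat n with hu
  have hun : u.length = n := length_unary_x n
  have hL : (S (boolPair u (boolPair [] (List.replicate (a.eval u.length) false)))).length = L n := by
    rw [hun]; exact hb n 0 _ (List.length_replicate ..)
  have hinit : initX S a m (boolPair u h) =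
      boolPair (boolPair u h) (boolPair (encodeNat (m.eval n)) (boolPair (ones 0) (List.replicate (L n) false))) := by
    rw [initX, fanoutFn_apply, fanoutFn_apply, fanoutFn_apply, id, Function.comp_apply, Function.comp_apply,
      fstF_boolPair, polyFn_apply, lenBinF_apply, List.length_replicate, hun, Function.comp_apply, lenF_apply, hL,
      Kannan.zerosFn_apply, List.length_replicate]
    rfl
  have hkM : m.eval n ≤ m.eval (boolPair u h).length :=
    TM2Iter.eval_mono m (by rw [length_boolPair, hun]; omega)
  have hpieces : ∀ j, j < m.eval n → (pieceX S a (boolPair (boolPair u h) (ones j))).length ≤ 1 * ((boolPair u h).length + 1) := by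
    intro j hj
    rw [pieceX_apply, hL, length_boolPair, one_mul,
      Hybrid.length_blk_of_le (N := L n) (j := j) (R := h) (by rw [hh]; exact Nat.mul_le_mul_right _ (by omega))]
    have : L n ≤ m.eval n * L n := Nat.le_mul_of_pos_left _ (by omega)
    omega
  rw [xorFoldFn, Function.comp_apply, Function.comp_apply, hinit, foldLoop_apply _ _ hkM 0,
    sndPow_succ_boolPair, sndPow_succ_boolPair, sndPow_zero_boolPair]
  have hclip : foldAcc opX (clipF 1 (pieceX S a)) (boolPair u h) 0 (m.eval n) (List.replicate (L n) false) =
      foldAcc opX (pieceX S a) (boolPair u h) 0 (m.eval n) (List.replicate (L n) false) :=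
    foldAcc_clipF (fun j _ hj => hpieces j (by omega))
  have hmap : ((List.range (m.eval n)).map fun j => pieceX S a (boolPair (boolPair u h) (ones (0 + j)))) =
      (List.range (m.eval n)).map fun j => blk (L n) j h :=
    List.map_congr_left fun j _ => by rw [zero_add, pieceX_apply, hL]
  rw [hclip, foldAcc_opX, hmap]
  rfl

/-- Output length of the XOR fold on genuine inputs: `L(n)`. [folklore] -/
theorem length_xorFoldFn {L : ℕ → ℕ} (hb : HasOutLenI S a L) {n : ℕ} {h : List Bool} (hh : h.length = m.eval n * L n) :
    (xorFoldFn S a m (boolPair (unaryEncodeNat n) h)).length = L n := by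
  rw [xorFoldFn_apply hb hh, length_xorBlocks]

end XorComb

open XorComb

/-! ### Blocks of concatenations -/

/-- Block `i` of a concatenation of `M` blocks of length `L` is the `i`-th block. [folklore] -/
theorem blk_flatten_eq {L : ℕ} : ∀ (bs : List (List Bool)), (∀ b ∈ bs, b.length = L) → ∀ i < bs.length,
    blk L i bs.flatten = bs[i]!
  | [], _, i, hi => absurd hi (Nat.not_lt_zero i)
  | b :: bs, hbs, 0, _ => by
    have hb : b.length = L := hbs b List.mem_cons_self
    simp only [Hybrid.blk, Nat.zero_mul, List.drop_zero, List.flatten_cons]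
    rw [List.take_append_of_le_length hb.ge, List.take_of_length_le hb.le]
    rfl
  | b :: bs, hbs, i + 1, hi => by
    have hb : b.length = L := hbs b List.mem_cons_self
    have ih := blk_flatten_eq bs (fun b' hb' => hbs b' (List.mem_cons_of_mem _ hb')) i (by simpa using hi)
    rw [List.flatten_cons]
    simp only [Hybrid.blk] at ih ⊢
    rw [List.drop_append, hb, List.drop_of_length_le (by rw [hb, Nat.succ_mul]; omega), List.nil_append,
      show (i + 1) * L - L = i * L by rw [Nat.succ_mul]; omega, ih]
    simp

/-- The blocks of a concatenation of `M` blocks of length `L`. [folklore] -/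
theorem map_blk_flatten {L : ℕ} (bs : List (List Bool)) (hbs : ∀ b ∈ bs, b.length = L) :
    ((List.range bs.length).map fun i => blk L i bs.flatten) = bs := by
  apply List.ext_getElem (by simp)
  intro i h₁ h₂
  rw [List.getElem_map, List.getElem_range, blk_flatten_eq bs hbs i h₂, List.getElem!_eq_getElem?_getD,
    List.getElem?_eq_getElem h₂]
  rfl

/-! ### The combiner -/

/-- **The XOR combiner (HILL 1999, step 4): if one candidate is pseudorandom, the XOR of all candidates on
independent seeds is pseudorandom.** Let `S ∈ FP` be an indexed sampler of common output length `L(n)`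
(`G_i(s) = S(⟨1ⁿ, ⟨1ⁱ, s⟩⟩)`, seeds of `a(n)` bits), `k₀(n) < m(n)` a sequence of indices, and suppose the
`k₀(n)`-th candidate `n ↦ G_{k₀(n)}(U_{a(n)})` is pseudorandom against `U_{L(n)}`. Then
`n ↦ G₀(s₀) ⊕ ⋯ ⊕ G_{m(n)−1}(s_{m(n)−1})` (`sᵢ ← U_{a(n)}` independent, read off `U_{m(n)a(n)}`; XOR via
`xorBlocks`) is pseudorandom against `U_{L(n)}`. The index `k₀` need not be computable (it is the
"correct guess" of the enumeration). [cite: HastadImpagliazzoLevinLuby1999, §4 (enumeration and XOR of candidate generators; HRV13 §1.1)] -/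
theorem isPseudorandom_xorCombiner {S : List Bool → List Bool} {a m : Polynomial ℕ} {L : ℕ → ℕ}
    (hS : S ∈ FP) (hb : HasOutLenI S a L) {k₀ : ℕ → ℕ} (hk : ∀ n, k₀ n < m.eval n)
    (hgood : IsPseudorandom (seedEnsembleI S a k₀) L) :
    IsPseudorandom (fun n => (uniformBits (m.eval n * a.eval n)).map fun R =>
        xorBlocks (L n) ((List.range (m.eval n)).map fun i =>
          S (boolPair (unaryEncodeNat n) (boolPair (ones i) (blk (a.eval n) i R)))))
      L := by
  -- Step 1: replace the `k₀(n)`-th component by `U_{L(n)}`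
  have hWl : ∀ n, ∀ s ∈ (uniformEnsemble L n).support, s.length = L n :=
    fun n s hs => length_eq_of_mem_support_uniformBits hs
  have h1 : IsCompIndistinguishable (prodEnsembleI S a m) (replEnsemble S a m k₀ (uniformEnsemble L)) :=
    isCompIndistinguishable_prodEnsembleI_replEnsemble hS hb hk hgood hWl
  -- Step 2: apply the XOR fold (polynomial-time post-processing)
  obtain ⟨B, hB⟩ := hb.exists_poly_le hS
  have hX : ∀ n, ∀ s ∈ (prodEnsembleI S a m n).support, s.length = m.eval n * L n := by
    intro n s hs
    unfold prodEnsembleI at hs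
    rw [PMF.mem_support_map_iff] at hs
    obtain ⟨R, hR, rfl⟩ := hs
    exact length_flatten_map_range fun i hi => hb n i _ (Hybrid.length_blk_of_le (by
      rw [length_eq_of_mem_support_uniformBits hR]; exact Nat.mul_le_mul_right _ hi))
  have hY : ∀ n, ∀ s ∈ (replEnsemble S a m k₀ (uniformEnsemble L) n).support, s.length = m.eval n * L n := by
    intro n s hs
    unfold replEnsemble at hs
    rw [PMF.mem_support_bind_iff] at hs
    obtain ⟨α, hα, hs⟩ := hs
    rw [PMF.mem_support_map_iff] at hs
    obtain ⟨R', hR', rfl⟩ := hs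
    exact length_hybInsI_eq hb (hk n) (length_eq_of_mem_support_uniformBits hα)
      (length_eq_of_mem_support_uniformBits hR')
  have h2 := IsCompIndistinguishable.map_fp h1 hX hY ⟨m * B, fun n => by
      have := hB n; simpa using Nat.mul_le_mul_left (m.eval n) this⟩ (xorFoldFn_mem_FP S a m hS)
    (F := xorFoldFn S a m) (ℓ' := L) (fun n s hs => length_xorFoldFn hb hs)
  -- Step 3: identify the two post-processed ensembles
  have hleft : (fun n => (prodEnsembleI S a m n).map fun s => xorFoldFn S a m (boolPair (unaryEncodeNat n) s)) =
      fun n => (uniformBits (m.eval n * a.eval n)).map fun R =>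
        xorBlocks (L n) ((List.range (m.eval n)).map fun i =>
          S (boolPair (unaryEncodeNat n) (boolPair (ones i) (blk (a.eval n) i R)))) := by
    funext n
    unfold prodEnsembleI
    rw [PMF.map_comp, uniformBits, PMF.map_comp, PMF.map_comp]
    congr 1
    funext v
    simp only [Function.comp_apply]
    have hbs : ∀ b ∈ (List.range (m.eval n)).map (fun i =>
        S (boolPair (unaryEncodeNat n) (boolPair (ones i) (blk (a.eval n) i v.toList)))), b.length = L n := by
      intro b hb'
      rw [List.mem_map] at hb'
      obtain ⟨i, hi, rfl⟩ := hb'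
      rw [List.mem_range] at hi
      exact hb n i _ (Hybrid.length_blk_of_le (by rw [v.toList_length]; exact Nat.mul_le_mul_right _ hi))
    rw [xorFoldFn_apply hb (length_flatten_map_range fun i hi => hbs _ (List.mem_map.2 ⟨i, List.mem_range.2 hi, rfl⟩))]
    congr 1
    have h := map_blk_flatten _ hbs
    rw [List.length_map, List.length_range] at h
    exact h
  have hright : (fun n => (replEnsemble S a m k₀ (uniformEnsemble L) n).map fun s =>
      xorFoldFn S a m (boolPair (unaryEncodeNat n) s)) = uniformEnsemble L := by
    funext n
    unfold replEnsemble uniformEnsemble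
    rw [PMF.map_bind]
    -- inside: the fold of the tuple with `α` at position `k₀ n` is `(fold of the others) ⊕ α`
    have hker : ∀ α ∈ (uniformBits (L n)).support,
        ((uniformBits ((m.eval n - 1) * a.eval n)).map fun R' =>
            hybInsI (atLevelI S n) (atLevelI S n) (a.eval n) (m.eval n) (k₀ n) α R').map
          (fun s => xorFoldFn S a m (boolPair (unaryEncodeNat n) s)) =
        (uniformBits ((m.eval n - 1) * a.eval n)).map fun R' =>
          bxor (xorBlocks (L n)
            (((List.range (k₀ n)).map fun i => atLevelI S n i (blk (a.eval n) i R')) ++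
              ((List.range (m.eval n - 1 - k₀ n)).map fun i => atLevelI S n (k₀ n + 1 + i) (blk (a.eval n) (k₀ n + i) R'))))
            α := by
      intro α hα
      have hαl : α.length = L n := length_eq_of_mem_support_uniformBits hα
      rw [PMF.map_comp, uniformBits, PMF.map_comp, PMF.map_comp]
      congr 1
      funext v
      simp only [Function.comp_apply]
      have hRl : v.toList.length = (m.eval n - 1) * a.eval n := v.toList_length
      have hA : ∀ b ∈ (List.range (k₀ n)).map (fun i => atLevelI S n i (blk (a.eval n) i v.toList)), b.length = L n := by
        intro b hb'; rw [List.mem_map] at hb'; obtain ⟨i, hi, rfl⟩ := hb'; rw [List.mem_range] at hi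
        exact hb n i _ (Hybrid.length_blk_of_le (by rw [hRl]; exact Nat.mul_le_mul_right _ (by have := hk n; omega)))
      have hBl : ∀ b ∈ (List.range (m.eval n - 1 - k₀ n)).map (fun i =>
          atLevelI S n (k₀ n + 1 + i) (blk (a.eval n) (k₀ n + i) v.toList)), b.length = L n := by
        intro b hb'; rw [List.mem_map] at hb'; obtain ⟨i, hi, rfl⟩ := hb'; rw [List.mem_range] at hi
        exact hb n _ _ (Hybrid.length_blk_of_le (by rw [hRl]; exact Nat.mul_le_mul_right _ (by omega)))
      set A := (List.range (k₀ n)).map fun i => atLevelI S n i (blk (a.eval n) i v.toList) with hAdef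
      set Bl := (List.range (m.eval n - 1 - k₀ n)).map fun i =>
        atLevelI S n (k₀ n + 1 + i) (blk (a.eval n) (k₀ n + i) v.toList) with hBdef
      have hall : ∀ b ∈ A ++ α :: Bl, b.length = L n := by
        intro b hb'
        rw [List.mem_append, List.mem_cons] at hb'
        rcases hb' with h | rfl | h
        · exact hA b h
        · exact hαl
        · exact hBl b h
      have hflat : hybInsI (atLevelI S n) (atLevelI S n) (a.eval n) (m.eval n) (k₀ n) α v.toList = (A ++ α :: Bl).flatten := by
        simp [hybInsI, hAdef, hBdef, List.flatten_append, List.append_assoc]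
      have hlen : (A ++ α :: Bl).length = m.eval n := by simp [hAdef, hBdef]; have := hk n; omega
      have hlenf : (A ++ α :: Bl).flatten.length = m.eval n * L n := by
        rw [← hflat]; exact length_hybInsI_eq hb (hk n) hαl hRl
      rw [hflat, xorFoldFn_apply hb hlenf]
      have h := map_blk_flatten _ hall
      rw [hlen] at h
      rw [h, xorBlocks_append_cons hαl hBl]
    rw [pmf_bind_congr_of_mem_support _ hker]
    exact uniformBits_bind_map_bxor _ fun R' => length_xorBlocks _ _
  rw [hleft, hright] at h2
  exact h2

end Literature.Computability.Cryptography
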